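import Literature.Probability.Percolation.SlabRSWGluingLinear
import Literature.Probability.Percolation.SlabGluingFact2
import HarnessLib

/-!
# Newman–Tassion–Wu 2017, §3.2, proof of Theorem 3.7 — FACT 1 (the anti-gluing map) in general
# position: `P[𝒳_ρ ∩ {|U| ≤ t}] ≤ C₁^t · P[(C̄ ⟷^{R̄} 𝒩(Γ̄, ρ))ᶜ]` when `C` is far from `S`

Topic: `Literature/Probability/Percolation`. First file of the HIGH-PROBABILITY regime (Layer 1b)
of the port of §3 of Newman–Tassion–Wu, *Critical percolation and the minimal spanning tree in
slabs* (CPAM 70 (2017); arXiv:1512.09107), on top of the general-position data `NTW17.GlueData`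
(`SlabRSWGluingCore.lean`: planar domains `S ⊆ R`, source `A`, target `B`, far set `C`; minimal path
`Γ = Γ_min^S(A,B)`; events `evAB`, `evCA`, `evX`, and, with a radius `ρ`, `evNear ρ`
(`C̄ ⟷^{R̄} 𝒩(Γ̄, ρ)`) and `evXn ρ = evX ∩ evNear ρ` = NTW's `𝒳`).

Printed statement (p. 9): "**Fact 1.** There exists `C₁ < ∞`, depending only on `ε`, such that for
any `t > 0`, `P_p[𝒳 ∩ {|U| ≤ t}] ≤ (C₁)^t P_p[(C ⟷^R 𝒩(Γ̄, r))ᶜ]`. We prove this statement by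
constructing a disconnecting (or anti-gluing) map `Φ : 𝒳 ∩ {|U| ≤ t} → {C ⟷^R 𝒩(Γ̄, r)}ᶜ` such
that for any `ω′` in the image of `Φ`, the cardinality of its pre-image is bounded by a constant
depending only on `t`."  Here `U(ω)` is the set of vertices `z ∈ Γ̄` such that `B̄_{r+1}(z)` is
connected to `C` in `R` by an open path `π` with `dist*(π, Γ̄) = r + 1`.

This file proves Fact 1 in the form the tree's `NTW17.exists_delta_of_facts` consumes, for every
`GlueData` whose far set `C` is at sup-distance `> ρ` from `S` — the DESIGN REPAIR of record
(lead GEN 37, V426): when `C̄` itself meets `𝒩(Γ̄, ρ)` (a "degenerate contact", by a trivial path)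
no map closing edges can disconnect `C` from `𝒩(Γ̄, ρ)`, and for the lex-minimal `Γ` such contacts
are typical, not rare; every use of the high-probability regime in §3 admits the far form.  The
map is the tree's DST-style anti-gluing (`SlabGluingFact1.lean`, `GlueGeom.phi1`) transplanted:
close every open edge `{u, v}` ENTERING the neighbourhood (`v` within `ρ` of `Γ̄`, `u` not) from a
vertex `u` joined to `C̄` inside `R̄` OFF the neighbourhood.

* `GlueData.JoinedFar`, `GlueData.Uset` (NTW's `U(ω)`, radius `ρ + 1`), `GlueData.closeSet`,
  `GlueData.phi1` (the map `Φ`).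
* PROVED: `γ_phi1` (`Γ(Φ ω) = Γ(ω)`: no edge of `Γ` is closed), `Uset_phi1` (`U(Φ ω) = U(ω)`: the
  witnessing paths run off the neighbourhood and are untouched), `phi1_not_mem_evNear` (`Φ ω ∉
  {C̄ ⟷ 𝒩(Γ̄, ρ)}`: follow an open path of `Φ ω` from `C̄` to its first vertex within `ρ`; the edge
  into it was closed — this is where `C` far from `S` enters), `diff_phi1_subset` (the closed edges
  sit in columns within `ρ + 1` of points of `U(Φ ω)`), and
  **`NTW17.fact1`**: `P[evXn ρ ∩ {|U| ≤ t}] ≤ (2/min{p,1-p})^{(5k+4)(2ρ+3)² t} · P[(evNear ρ)ᶜ]`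
  (Lemma 3.5 = the tree's `lemma7_bond` with one image per configuration).

What this file does NOT do: Fact 2 with `|U| > t` (the multi-valued local surgery at `≥ t/const`
separated points of `U`, next file), and the `ε-δ` conclusion (`exists_delta_of_facts`).

## Sources

* C. M. Newman, V. Tassion, W. Wu, *Critical percolation and the minimal spanning tree in
  slabs*, Comm. Pure Appl. Math. 70 (2017) 2084–2120, arXiv:1512.09107: §3.2, proof of
  Theorem 3.7, the set `U(ω)` and Fact 1 (p. 9 of the arXiv text) [NewmanTassionWu2017].
* H. Duminil-Copin, V. Sidoravicius, V. Tassion, CPAM 69 (2016), §2.3, Fact 1 (the same map in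
  special geometry; the tree's `SlabGluingFact1.lean`) [DuminilCopinSidoraviciusTassion2016].
-/

noncomputable section

namespace Literature.Probability.Percolation

open MeasureTheory LatticeModels SimpleGraph Finset

namespace NTW17

variable {k : ℕ}

/-! ## The statistic `U(ω)` and the anti-gluing map -/

namespace GlueData

variable (Q : GlueData) (k) (ρ : ℕ)

/-- **`u` is joined to `C̄` off the neighbourhood**: some vertex of `C̄` is joined to `u` by an open
path inside `R̄` none of whose vertices projects within `ρ` of the columns of `Γ` (NTW's paths `π`
with `dist*(π, Γ̄) ≥ r + 1`). [cite: NewmanTassionWu2017, §3.2 (proof of Theorem 3.7, definition of U(ω))] -/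
def JoinedFar (ω : BondConfig (slab 3 k)) (u : slab 3 k) : Prop :=
  ∃ c₀ ∈ slabLift k Q.C, ω ∈ openConnIn (slabLift k Q.R ∩ {v | ¬Near k (Q.γ k ω) ρ (planar k v)}) c₀ u

/-- **NTW's `U(ω)`** (radius `ρ + 1`): the columns `z` of `Γ` such that some vertex `u` projecting
within `ρ + 1` of `z`, and not within `ρ` of `Γ̄`, is joined to `C̄` off the neighbourhood.
[cite: NewmanTassionWu2017, §3.2 (proof of Theorem 3.7, definition of U(ω))] -/
def Uset (ω : BondConfig (slab 3 k)) : Set (ℤ × ℤ) :=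
  {z | (∃ g ∈ Q.γ k ω, planar k g = z) ∧
    ∃ u : slab 3 k, planar k u ∈ sqBox z (ρ + 1) ∧ ¬Near k (Q.γ k ω) ρ (planar k u) ∧ Q.JoinedFar k ρ ω u}

/-- **The edges closed by `Φ`**: the open edges `{u, v}` with `v` within `ρ` of `Γ̄`, `u` not, and `u`
joined to `C̄` off the neighbourhood. [cite: NewmanTassionWu2017, §3.2 (proof of Theorem 3.7, Fact 1, the map Φ)] -/
def closeSet (ω : BondConfig (slab 3 k)) : Set (Sym2 (slab 3 k)) :=
  {e | e ∈ ω ∧ ∃ u v, e = s(u, v) ∧ Near k (Q.γ k ω) ρ (planar k v) ∧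
    ¬Near k (Q.γ k ω) ρ (planar k u) ∧ Q.JoinedFar k ρ ω u}

/-- **The anti-gluing map `Φ`**: close the edges of `closeSet`. [cite: NewmanTassionWu2017, §3.2 (proof of Theorem 3.7, Fact 1, the map Φ)] -/
def phi1 (ω : BondConfig (slab 3 k)) : BondConfig (slab 3 k) := ω \ Q.closeSet k ρ ω

variable {Q k ρ}

/-- `Φ(ω) ⊆ ω`. [cite: NewmanTassionWu2017, §3.2 (proof of Theorem 3.7, Fact 1)] -/
theorem phi1_subset (ω : BondConfig (slab 3 k)) : Q.phi1 k ρ ω ⊆ ω := fun _ h => h.1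

/-- `U(ω)` lies in the set of columns of `Γ`, which is finite. [cite: NewmanTassionWu2017, §3.2 (proof of Theorem 3.7, U(ω) ⊆ Γ̄)] -/
theorem Uset_finite (ω : BondConfig (slab 3 k)) : (Q.Uset k ρ ω).Finite := by
  have h : Q.Uset k ρ ω ⊆ (planar k) '' {x | x ∈ Q.γ k ω} := fun z hz => by
    obtain ⟨⟨g, hg, rfl⟩, -⟩ := hz; exact ⟨g, hg, rfl⟩
  exact ((List.finite_toSet _).image _).subset h

/-- A vertex of `Γ` is within `ρ` of `Γ̄`. [cite: NewmanTassionWu2017, §3.2 (𝒩(Γ̄, r))] -/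
theorem near_of_mem_γ {ω : BondConfig (slab 3 k)} {g : slab 3 k} (hg : g ∈ Q.γ k ω) :
    Near k (Q.γ k ω) ρ (planar k g) :=
  ⟨g, hg, mem_sqBox_self _ _⟩

/-- No edge joining two vertices of `Γ` is closed by `Φ` (a closed edge has an endpoint off the
neighbourhood). [cite: NewmanTassionWu2017, §3.2 (proof of Theorem 3.7, Fact 1: "which are not in Γ")] -/
theorem not_mem_closeSet_of_mem_γ {ω : BondConfig (slab 3 k)} {a b : slab 3 k}
    (ha : a ∈ Q.γ k ω) (hb : b ∈ Q.γ k ω) : s(a, b) ∉ Q.closeSet k ρ ω := by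
  rintro ⟨-, u, v, heq, -, hu, -⟩
  have hu' : u ∈ Q.γ k ω := by
    have : u ∈ s(a, b) := by rw [heq]; exact Sym2.mem_mk_left u v
    rcases Sym2.mem_iff.1 this with rfl | rfl
    · exact ha
    · exact hb
  exact hu (near_of_mem_γ hu')

/-- **`Γ(Φ ω) = Γ(ω)`**: `Γ` stays open, and closing edges can only remove competitors.
[cite: NewmanTassionWu2017, §3.2 (proof of Theorem 3.7, Fact 1)] -/
theorem γ_phi1 (ω : BondConfig (slab 3 k)) : Q.γ k (Q.phi1 k ρ ω) = Q.γ k ω := by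
  by_cases hA : ω ∈ Q.evAB k
  · have hγ := (Q.γ_spec hA).1
    exact minPath_eq_of_subset (phi1_subset ω) Q.S_finite
      ((mem_slabConn_iff_exists_isOSAP ω _ _ _).1 hA)
      (hγ.of_edges fun a ha b hb hab => ⟨hab, not_mem_closeSet_of_mem_γ ha hb⟩)
  · -- no path at all: `Γ = []`, nothing is near, nothing is closed
    have hγ : Q.γ k ω = [] := minPath_eq_nil fun h => hA ((mem_slabConn_iff_exists_isOSAP ω _ _ _).2 h)
    have hcl : Q.closeSet k ρ ω = ∅ := by
      ext e
      simp only [closeSet, Set.mem_setOf_eq, Set.mem_empty_iff_false, iff_false]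
      rintro ⟨-, u, v, -, ⟨g, hg, -⟩, -⟩
      rw [hγ] at hg; simp at hg
    simp [phi1, hcl]

/-- Edges with both endpoints off the neighbourhood are untouched by `Φ`. [cite: NewmanTassionWu2017, §3.2 (proof of Theorem 3.7, Fact 1)] -/
theorem mem_phi1_iff_of_far {ω : BondConfig (slab 3 k)} {e : Sym2 (slab 3 k)}
    (he : e ∈ (slabLift k Q.R ∩ {v | ¬Near k (Q.γ k ω) ρ (planar k v)}).sym2) :
    e ∈ ω ↔ e ∈ Q.phi1 k ρ ω := by
  refine ⟨fun h => ⟨h, ?_⟩, fun h => h.1⟩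
  rintro ⟨-, u, v, rfl, hv, -, -⟩
  exact (Set.mk_mem_sym2_iff.1 he).2.2 hv

/-- `JoinedFar` is unchanged by `Φ`. [cite: NewmanTassionWu2017, §3.2 (proof of Theorem 3.7, Fact 1)] -/
theorem joinedFar_phi1_iff {ω : BondConfig (slab 3 k)} (u : slab 3 k) :
    Q.JoinedFar k ρ (Q.phi1 k ρ ω) u ↔ Q.JoinedFar k ρ ω u := by
  simp only [JoinedFar, γ_phi1]
  refine exists_congr fun c₀ => and_congr_right fun _ => ?_
  exact (openConnIn_congr (fun e he => mem_phi1_iff_of_far he) c₀ u).symm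

/-- **`U(Φ ω) = U(ω)`** ("we can reconstruct" the closed set from the image).
[cite: NewmanTassionWu2017, §3.2 (proof of Theorem 3.7, Fact 1: the pre-image is bounded)] -/
theorem Uset_phi1 (ω : BondConfig (slab 3 k)) : Q.Uset k ρ (Q.phi1 k ρ ω) = Q.Uset k ρ ω := by
  ext z
  simp only [Uset, Set.mem_setOf_eq, γ_phi1, joinedFar_phi1_iff]

/-- The closed edges lie in columns within `ρ + 1` of points of `U(Φ ω)` (lattice configurations).
[cite: NewmanTassionWu2017, §3.2 (proof of Theorem 3.7, Fact 1: "the cardinality of its pre-image is bounded")] -/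
theorem diff_phi1_subset {ω : BondConfig (slab 3 k)} (hω : ω ⊆ (slabGraph 3 k).edgeSet) :
    ω \ Q.phi1 k ρ ω ⊆ {e | ∃ u ∈ e, ∃ z ∈ Q.Uset k ρ (Q.phi1 k ρ ω), planar k u ∈ sqBox z (ρ + 1)} := by
  rintro e ⟨he, hne⟩
  have he' : e ∈ Q.closeSet k ρ ω := by
    by_contra h
    exact hne ⟨he, h⟩
  obtain ⟨heω, u, v, rfl, ⟨g, hg, hv⟩, hu, hj⟩ := he'
  refine ⟨u, Sym2.mem_mk_left u v, planar k g, ?_, ?_⟩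
  · rw [Uset_phi1]
    exact ⟨⟨g, hg, rfl⟩, u, mem_sqBox_add hv (planar_mem_sqBox_one_of_adj
      ((SimpleGraph.mem_edgeSet _).1 (hω heω)).symm), hu, hj⟩
  · exact mem_sqBox_add hv (planar_mem_sqBox_one_of_adj ((SimpleGraph.mem_edgeSet _).1 (hω heω)).symm)

/-- **`Φ` disconnects `C̄` from `𝒩(Γ̄, ρ)`** when `C` is at sup-distance `> ρ` from `S` (so that no
vertex of `C̄` is itself within `ρ` of `Γ̄ ⊆ S̄`): follow an open path of `Φ ω` inside `R̄` from `C̄`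
to its first vertex within `ρ` of `Γ̄`; the edge into that vertex lies in `closeSet ω`.
[cite: NewmanTassionWu2017, §3.2 (proof of Theorem 3.7, Fact 1: "Φ(ω) cannot contain any open path from C to 𝒩(Γ̄, r)")] -/
theorem phi1_not_mem_evNear (hfar : ∀ c ∈ Q.C, ∀ s ∈ Q.S, c ∉ sqBox s ρ) {ω : BondConfig (slab 3 k)} :
    Q.phi1 k ρ ω ∉ Q.evNear k ρ := by
  rintro ⟨c₀, hc₀, q, hj, hnear⟩
  rw [γ_phi1] at hnear
  -- `Γ` exists (else nothing is near), and lies in `S̄`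
  have hA : ω ∈ Q.evAB k := by
    by_contra hA
    have hγ : Q.γ k ω = [] := minPath_eq_nil fun h => hA ((mem_slabConn_iff_exists_isOSAP ω _ _ _).2 h)
    obtain ⟨g, hg, -⟩ := hnear
    rw [hγ] at hg; simp at hg
  have hγS : ∀ g ∈ Q.γ k ω, g ∈ slabLift k Q.S := (Q.γ_spec hA).1.subset
  -- an open self-avoiding path of `Φ ω` inside `R̄` from `c₀` to `q`
  obtain ⟨L, hL⟩ := exists_isOSAP_of_openConnIn hj
  have hqL : q ∈ L := by
    have := hL.last_mem hL.ne_nil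
    rw [Set.mem_singleton_iff] at this
    rw [← this]; exact List.getLast_mem _
  obtain ⟨l, x₁, l₂, hLeq, hx₁, hl⟩ :=
    exists_first_split (p := fun x => Near k (Q.γ k ω) ρ (planar k x)) L ⟨q, hqL, hnear⟩
  -- `c₀` is not near: `l ≠ []`
  have hc₀far : ¬Near k (Q.γ k ω) ρ (planar k c₀) := by
    rintro ⟨g, hg, hc⟩
    exact hfar (planar k c₀) hc₀ (planar k g) (hγS g hg) hc
  have hhead : L.head hL.ne_nil = c₀ := by
    have := hL.head_mem hL.ne_nil
    rwa [Set.mem_singleton_iff] at this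
  have hl0 : l ≠ [] := by
    rintro rfl
    simp only [List.nil_append] at hLeq
    have : L.head hL.ne_nil = x₁ := by simp [hLeq]
    rw [hhead] at this
    rw [this] at hc₀far
    exact hc₀far hx₁
  -- the last vertex `x₀` of `l` and the edge `{x₀, x₁}`
  obtain ⟨l₁, x₀, hlx⟩ := l.eq_nil_or_concat.resolve_left hl0
  rw [List.concat_eq_append] at hlx
  subst hlx
  have hchain := hL.chain
  rw [hLeq, show (l₁ ++ [x₀]) ++ x₁ :: l₂ = l₁ ++ (x₀ :: x₁ :: l₂) by simp] at hchain
  have hedge : s(x₀, x₁) ∈ Q.phi1 k ρ ω ∧ x₀ ≠ x₁ :=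
    (List.isChain_cons_cons.1 (List.isChain_append.1 hchain).2.1).1
  have hx₀far : ¬Near k (Q.γ k ω) ρ (planar k x₀) := hl x₀ (by simp)
  -- the prefix joins `c₀` to `x₀` off the neighbourhood, inside `R̄`
  have hjoin : Q.JoinedFar k ρ ω x₀ := by
    obtain ⟨c, rest, hlc⟩ := List.exists_cons_of_ne_nil hl0
    have hc : c = c₀ := by
      have h1 : L.head hL.ne_nil = c := by simp [hLeq, hlc]
      rw [← hhead, h1]
    rw [hc] at hlc
    have hpre : (l₁ ++ [x₀]).IsChain (fun a b => s(a, b) ∈ Q.phi1 k ρ ω ∧ a ≠ b) := by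
      have := hL.chain
      rw [hLeq, show (l₁ ++ [x₀]) ++ x₁ :: l₂ = (l₁ ++ [x₀]) ++ (x₁ :: l₂) by simp] at this
      exact (List.isChain_append.1 this).1
    rw [hlc] at hpre
    have hsub : ∀ x ∈ c₀ :: rest, x ∈ slabLift k Q.R ∩ {v | ¬Near k (Q.γ k ω) ρ (planar k v)} := by
      intro x hx
      have hxl : x ∈ l₁ ++ [x₀] := by rw [hlc]; exact hx
      exact ⟨hL.subset x (by rw [hLeq]; exact List.mem_append_left _ hxl), hl x hxl⟩
    have hconn := openConnIn_of_isChain c₀ rest hpre hsub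
    have hlast : (c₀ :: rest).getLast (List.cons_ne_nil c₀ rest) = x₀ := by
      simp only [← hlc, List.getLast_append_singleton]
    rw [hlast] at hconn
    refine (joinedFar_phi1_iff x₀).1 ⟨c₀, hc₀, ?_⟩
    rw [γ_phi1]
    exact hconn
  -- so the edge was closed
  have hclosed : s(x₀, x₁) ∈ Q.closeSet k ρ ω :=
    ⟨phi1_subset ω hedge.1, x₀, x₁, rfl, hx₁, hx₀far, hjoin⟩
  exact hedge.1.2 hclosed

/-! ## Determinacy by the window `R̄` -/

/-- `U(ω)` is determined by the edges inside `R̄`. [cite: NewmanTassionWu2017, §3.2 (proof of Theorem 3.7, Fact 1)] -/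
theorem Uset_congr {ω ω' : BondConfig (slab 3 k)} (h : ∀ e ∈ (slabLift k Q.R).sym2, e ∈ ω ↔ e ∈ ω') :
    Q.Uset k ρ ω = Q.Uset k ρ ω' := by
  have hγ : Q.γ k ω = Q.γ k ω' := Q.γ_congr h
  ext z
  simp only [Uset, JoinedFar, Set.mem_setOf_eq, hγ]
  refine and_congr_right fun _ => exists_congr fun u => and_congr_right fun _ => and_congr_right fun _ =>
    exists_congr fun c₀ => and_congr_right fun _ => ?_
  exact openConnIn_congr (fun e he => h e (sym2_mono Set.inter_subset_left he)) c₀ u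

/-- `C̄ ⟷^{R̄} 𝒩(Γ̄, ρ)` is determined by the edges inside `R̄`. [cite: NewmanTassionWu2017, §3.2 (Theorem 3.7, the event C ↔^R 𝒩(Γ̄, r))] -/
theorem mem_evNear_congr {ω ω' : BondConfig (slab 3 k)} (h : ∀ e ∈ (slabLift k Q.R).sym2, e ∈ ω ↔ e ∈ ω') :
    ω ∈ Q.evNear k ρ ↔ ω' ∈ Q.evNear k ρ := by
  simp only [evNear, Set.mem_setOf_eq, Q.γ_congr h, openConnIn_congr h]

end GlueData

/-! ## Fact 1 -/

section Fact1

open GlueData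

/-- The planar points within `ρ + 1` of `U`, as a finite set; at most `(2ρ+3)² |U|` of them. [folklore] -/
private theorem card_Ubox_le (Q : GlueData) (ρ : ℕ) (ω : BondConfig (slab 3 k)) :
    ((Uset_finite (Q := Q) (k := k) (ρ := ρ) ω).toFinset.biUnion
        fun z => (sqBox_finite z (ρ + 1)).toFinset).card ≤
      (2 * (ρ + 1) + 1) ^ 2 * (Q.Uset k ρ ω).ncard := by
  classical
  refine Finset.card_biUnion_le.trans ?_
  rw [Set.ncard_eq_toFinset_card _ (Uset_finite ω), mul_comm]
  refine (Finset.sum_le_sum fun z _ => card_toFinset_sqBox_le z (ρ + 1)).trans ?_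
  rw [Finset.sum_const, smul_eq_mul]

/-- **NTW 2017, proof of Theorem 3.7, FACT 1 — general position, `C` far from `S`.**  For every
`GlueData` `Q`, radius `ρ` with `dist*(C, S) > ρ`, `0 < p < 1` and `t`:
`P_p[𝒳_ρ ∩ {|U| ≤ t}] ≤ (2/min{p,1-p})^{(5k+4)(2ρ+3)² t} · P_p[(C̄ ⟷^{R̄} 𝒩(Γ̄, ρ))ᶜ]`.
Proof: the anti-gluing map `Φ` (`phi1`) sends `𝒳_ρ ∩ {|U| ≤ t}` into `(evNear ρ)ᶜ`
(`phi1_not_mem_evNear`), and every preimage of `ω′` agrees with `ω′` off the at most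
`(5k+4)(2ρ+3)² t` lattice edges in the columns within `ρ+1` of `U(ω′) = U(ω)` (`Uset_phi1`,
`diff_phi1_subset`); Lemma 3.5 (`lemma7_bond`, one image) concludes.
[cite: NewmanTassionWu2017, §3.2 (proof of Theorem 3.7, Fact 1)] -/
theorem fact1 (Q : GlueData) (ρ : ℕ) (hfar : ∀ c ∈ Q.C, ∀ s ∈ Q.S, c ∉ sqBox s ρ)
    (p : unitInterval) (hp0 : 0 < (p : ℝ)) (hp1 : (p : ℝ) < 1) (t : ℕ) :
    (bondPercolation (slabGraph 3 k) p).real (Q.evXn k ρ ∩ {ω | (Q.Uset k ρ ω).ncard ≤ t}) ≤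
      (2 / min (p : ℝ) (1 - p)) ^ ((5 * k + 4) * ((2 * (ρ + 1) + 1) ^ 2 * t)) *
        (bondPercolation (slabGraph 3 k) p).real (Q.evNear k ρ)ᶜ := by
  classical
  set P := bondPercolation (slabGraph 3 k) p with hP
  -- the window
  have hRfin : (slabLift k Q.R).Finite := slabLift_finite k Q.hRfin
  set K' : Finset (Sym2 (slab 3 k)) := (finite_sym2 hRfin).toFinset with hK'def
  have hK'coe : (↑K' : Set (Sym2 (slab 3 k))) = (slabLift k Q.R).sym2 := Set.Finite.coe_toFinset _
  set Kfin : Finset (Sym2 (slab 3 k)) := K'.filter (· ∈ (slabGraph 3 k).edgeSet) with hKfin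
  have hK : ∀ e, e ∈ Kfin ↔ e ∈ K' ∧ e ∈ (slabGraph 3 k).edgeSet := fun e => Finset.mem_filter
  have hKE : ∀ e ∈ Kfin, e ∈ (slabGraph 3 k).edgeSet := fun e he => ((hK e).1 he).2
  -- agreement on the window
  have hagree : ∀ ω ω' : BondConfig (slab 3 k), ω ∩ ↑K' = ω' ∩ ↑K' →
      ∀ e ∈ (slabLift k Q.R).sym2, e ∈ ω ↔ e ∈ ω' := by
    intro ω ω' heq e he
    rw [← hK'coe] at he
    have := Set.ext_iff.1 heq e
    simp only [Set.mem_inter_iff, he, and_true] at this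
    exact this
  have hA : DeterminedBy (Q.evXn k ρ ∩ {ω | (Q.Uset k ρ ω).ncard ≤ t}) ↑K' := by
    rw [determinedBy_iff]
    intro ω ω' heq
    simp only [Set.mem_inter_iff, Set.mem_setOf_eq]
    rw [Q.mem_evXn_congr (hagree ω ω' heq), Uset_congr (hagree ω ω' heq)]
  have hB : DeterminedBy (Q.evNear k ρ)ᶜ ↑K' := by
    rw [determinedBy_iff]
    intro ω ω' heq
    simp only [Set.mem_compl_iff]
    rw [mem_evNear_congr (hagree ω ω' heq)]
  -- the map, on lattice configurations inside the window
  let Φ : Finset (Sym2 (slab 3 k)) → Finset (Finset (Sym2 (slab 3 k))) :=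
    fun S => {S.filter (· ∉ Q.closeSet k ρ ↑S)}
  have hΦcoe : ∀ S : Finset (Sym2 (slab 3 k)),
      (↑(S.filter (· ∉ Q.closeSet k ρ ↑S)) : Set (Sym2 (slab 3 k))) = Q.phi1 k ρ ↑S := by
    intro S
    ext e
    simp [GlueData.phi1]
  have hmain := lemma7_bond (slabGraph 3 k) p hp0 hp1 K' Kfin hK hA hB
    ((5 * k + 4) * ((2 * (ρ + 1) + 1) ^ 2 * t)) one_pos Φ ?_ ?_ ?_
  · simpa using hmain
  · -- images lie in `B`
    intro S hS _ S' hS'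
    have hS'eq : S' = S.filter (· ∉ Q.closeSet k ρ ↑S) := Finset.mem_singleton.1 hS'
    subst hS'eq
    refine ⟨(Finset.filter_subset _ S).trans hS, ?_⟩
    rw [hΦcoe]
    exact phi1_not_mem_evNear hfar
  · -- one image
    intro S _ _
    simp [Φ]
  · -- preimages agree off the edges in the columns near `U(ω')`
    intro S' _ _
    by_cases hsmall : (Q.Uset k ρ (↑S' : BondConfig (slab 3 k))).ncard ≤ t
    · set Ubox : Finset (ℤ × ℤ) := (Uset_finite (Q := Q) (k := k) (ρ := ρ)
          (↑S' : BondConfig (slab 3 k))).toFinset.biUnion fun z => (sqBox_finite z (ρ + 1)).toFinset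
        with hUbox
      refine ⟨Kfin.filter fun e => ∃ u ∈ e, planar k u ∈ Ubox, ?_, ?_⟩
      · refine (card_filter_colEdges_le k Kfin hKE _).trans ?_
        refine Nat.mul_le_mul_left _ ((card_Ubox_le Q ρ _).trans ?_)
        exact Nat.mul_le_mul_left _ hsmall
      · intro S hS _ hmem e heT
        have hS'eq : S' = S.filter (· ∉ Q.closeSet k ρ ↑S) := Finset.mem_singleton.1 hmem
        constructor
        · intro heS
          by_contra heS'
          apply heT
          have hdiff : e ∈ (↑S : Set (Sym2 (slab 3 k))) \ Q.phi1 k ρ ↑S := by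
            refine ⟨heS, ?_⟩
            rw [← hΦcoe, ← hS'eq]
            exact heS'
          obtain ⟨u, hue, z, hz, hu⟩ := diff_phi1_subset (fun e he => hKE e (hS he)) hdiff
          rw [← hΦcoe, ← hS'eq] at hz
          refine Finset.mem_filter.2 ⟨hS heS, u, hue, ?_⟩
          rw [hUbox, Finset.mem_biUnion]
          exact ⟨z, (Set.Finite.mem_toFinset _).2 hz, (Set.Finite.mem_toFinset _).2 hu⟩
        · intro heS'
          rw [hS'eq] at heS'
          exact (Finset.mem_filter.1 heS').1
    · refine ⟨∅, by simp, ?_⟩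
      intro S _ hSA hmem
      exfalso
      apply hsmall
      have hS'eq : S' = S.filter (· ∉ Q.closeSet k ρ ↑S) := Finset.mem_singleton.1 hmem
      rw [hS'eq, hΦcoe, Uset_phi1]
      exact hSA.2

end Fact1

/-! ## Fact 1 for the ENTRY-CELL statistic

The same anti-gluing map, read through the statistic best suited to the geometric half of Fact 2:
the ENTRY CELLS `U_ent(ω)` — planar points `y` within `ρ` of `Γ̄` carrying a vertex `v` that is a
lattice neighbour of a vertex `u` NOT within `ρ` of `Γ̄` and joined to `C̄` off the neighbourhood
(the data of NTW's step (1): the point where an open path from `C` first comes within `r` of `Γ̄`;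
the tree's rectangle gadgets `exists_surgery_far` / `exists_surgery_ext` are centred at such a cell).
Every edge closed by `Φ` has an endpoint over an entry cell, entry cells do not depend on the state
of the entry edges, so `U_ent(Φ ω) = U_ent(ω)` and the preimages of `ω′` agree with `ω′` off the
`≤ (5k+4)|U_ent(ω′)|` lattice edges at the columns of entry cells. -/

namespace GlueData

variable (Q : GlueData) (k) (ρ : ℕ)

/-- **The entry cells `U_ent(ω)`**: planar points `y` within `ρ` of `Γ̄` over which some vertex `v` has a
lattice neighbour `u` not within `ρ` of `Γ̄` and joined to `C̄` inside `R̄` off the neighbourhood.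
[cite: NewmanTassionWu2017, §3.2 (proof of Theorem 3.7, step (1): "π … from w′ to C", dist*(π, Γ̄) = r+1)] -/
def Uent (ω : BondConfig (slab 3 k)) : Set (ℤ × ℤ) :=
  {y | Near k (Q.γ k ω) ρ y ∧ ∃ u v : slab 3 k, planar k v = y ∧ (slabGraph 3 k).Adj u v ∧
    ¬Near k (Q.γ k ω) ρ (planar k u) ∧ Q.JoinedFar k ρ ω u}

variable {Q k ρ}

/-- Entry cells lie within `ρ` of the (finitely many) columns of `Γ`: a finite set. [cite: NewmanTassionWu2017, §3.2 (proof of Theorem 3.7)] -/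
theorem Uent_finite (ω : BondConfig (slab 3 k)) : (Q.Uent k ρ ω).Finite := by
  have h : Q.Uent k ρ ω ⊆ ⋃ g ∈ {x | x ∈ Q.γ k ω}, sqBox (planar k g) ρ := by
    rintro y ⟨⟨g, hg, hy⟩, -⟩
    exact Set.mem_biUnion hg hy
  exact ((List.finite_toSet _).biUnion fun g _ => sqBox_finite _ _).subset h

/-- **`U_ent(Φ ω) = U_ent(ω)`.** [cite: NewmanTassionWu2017, §3.2 (proof of Theorem 3.7, Fact 1: bounded pre-image)] -/
theorem Uent_phi1 (ω : BondConfig (slab 3 k)) : Q.Uent k ρ (Q.phi1 k ρ ω) = Q.Uent k ρ ω := by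
  ext y
  simp only [Uent, Set.mem_setOf_eq, γ_phi1, joinedFar_phi1_iff]

/-- `U_ent(ω)` is determined by the edges inside `R̄`. [cite: NewmanTassionWu2017, §3.2 (proof of Theorem 3.7, Fact 1)] -/
theorem Uent_congr {ω ω' : BondConfig (slab 3 k)} (h : ∀ e ∈ (slabLift k Q.R).sym2, e ∈ ω ↔ e ∈ ω') :
    Q.Uent k ρ ω = Q.Uent k ρ ω' := by
  have hγ : Q.γ k ω = Q.γ k ω' := Q.γ_congr h
  ext y
  simp only [Uent, JoinedFar, Set.mem_setOf_eq, hγ]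
  refine and_congr_right fun _ => exists_congr fun u => exists_congr fun v => and_congr_right fun _ =>
    and_congr_right fun _ => and_congr_right fun _ => exists_congr fun c₀ => and_congr_right fun _ => ?_
  exact openConnIn_congr (fun e he => h e (sym2_mono Set.inter_subset_left he)) c₀ u

/-- The edges closed by `Φ` have an endpoint over an entry cell of `Φ ω` (lattice configurations).
[cite: NewmanTassionWu2017, §3.2 (proof of Theorem 3.7, Fact 1)] -/
theorem diff_phi1_subset_Uent {ω : BondConfig (slab 3 k)} (hω : ω ⊆ (slabGraph 3 k).edgeSet) :
    ω \ Q.phi1 k ρ ω ⊆ {e | ∃ v ∈ e, planar k v ∈ Q.Uent k ρ (Q.phi1 k ρ ω)} := by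
  rintro e ⟨he, hne⟩
  have he' : e ∈ Q.closeSet k ρ ω := by
    by_contra h
    exact hne ⟨he, h⟩
  obtain ⟨heω, u, v, rfl, hv, hu, hj⟩ := he'
  refine ⟨v, Sym2.mem_mk_right u v, ?_⟩
  rw [Uent_phi1]
  exact ⟨hv, u, v, rfl, (SimpleGraph.mem_edgeSet _).1 (hω heω), hu, hj⟩

end GlueData

section Fact1Ent

open GlueData

/-- **FACT 1 for the entry-cell statistic**: for every `GlueData` `Q`, radius `ρ` with
`dist*(C, S) > ρ`, `0 < p < 1` and `t`:
`P_p[𝒳_ρ ∩ {|U_ent| ≤ t}] ≤ (2/min{p,1-p})^{(5k+4) t} · P_p[(C̄ ⟷^{R̄} 𝒩(Γ̄, ρ))ᶜ]`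
(same map `Φ`; the preimages of `ω′` agree with `ω′` off the `≤ (5k+4) t` lattice edges at the
columns of the entry cells of `ω′`). [cite: NewmanTassionWu2017, §3.2 (proof of Theorem 3.7, Fact 1)] -/
theorem fact1_ent (Q : GlueData) (ρ : ℕ) (hfar : ∀ c ∈ Q.C, ∀ s ∈ Q.S, c ∉ sqBox s ρ)
    (p : unitInterval) (hp0 : 0 < (p : ℝ)) (hp1 : (p : ℝ) < 1) (t : ℕ) :
    (bondPercolation (slabGraph 3 k) p).real (Q.evXn k ρ ∩ {ω | (Q.Uent k ρ ω).ncard ≤ t}) ≤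
      (2 / min (p : ℝ) (1 - p)) ^ ((5 * k + 4) * t) *
        (bondPercolation (slabGraph 3 k) p).real (Q.evNear k ρ)ᶜ := by
  classical
  set P := bondPercolation (slabGraph 3 k) p with hP
  have hRfin : (slabLift k Q.R).Finite := slabLift_finite k Q.hRfin
  set K' : Finset (Sym2 (slab 3 k)) := (finite_sym2 hRfin).toFinset with hK'def
  have hK'coe : (↑K' : Set (Sym2 (slab 3 k))) = (slabLift k Q.R).sym2 := Set.Finite.coe_toFinset _
  set Kfin : Finset (Sym2 (slab 3 k)) := K'.filter (· ∈ (slabGraph 3 k).edgeSet) with hKfin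
  have hK : ∀ e, e ∈ Kfin ↔ e ∈ K' ∧ e ∈ (slabGraph 3 k).edgeSet := fun e => Finset.mem_filter
  have hKE : ∀ e ∈ Kfin, e ∈ (slabGraph 3 k).edgeSet := fun e he => ((hK e).1 he).2
  have hagree : ∀ ω ω' : BondConfig (slab 3 k), ω ∩ ↑K' = ω' ∩ ↑K' →
      ∀ e ∈ (slabLift k Q.R).sym2, e ∈ ω ↔ e ∈ ω' := by
    intro ω ω' heq e he
    rw [← hK'coe] at he
    have := Set.ext_iff.1 heq e
    simp only [Set.mem_inter_iff, he, and_true] at this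
    exact this
  have hA : DeterminedBy (Q.evXn k ρ ∩ {ω | (Q.Uent k ρ ω).ncard ≤ t}) ↑K' := by
    rw [determinedBy_iff]
    intro ω ω' heq
    simp only [Set.mem_inter_iff, Set.mem_setOf_eq]
    rw [Q.mem_evXn_congr (hagree ω ω' heq), Uent_congr (hagree ω ω' heq)]
  have hB : DeterminedBy (Q.evNear k ρ)ᶜ ↑K' := by
    rw [determinedBy_iff]
    intro ω ω' heq
    simp only [Set.mem_compl_iff]
    rw [mem_evNear_congr (hagree ω ω' heq)]
  let Φ : Finset (Sym2 (slab 3 k)) → Finset (Finset (Sym2 (slab 3 k))) :=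
    fun S => {S.filter (· ∉ Q.closeSet k ρ ↑S)}
  have hΦcoe : ∀ S : Finset (Sym2 (slab 3 k)),
      (↑(S.filter (· ∉ Q.closeSet k ρ ↑S)) : Set (Sym2 (slab 3 k))) = Q.phi1 k ρ ↑S := by
    intro S
    ext e
    simp [GlueData.phi1]
  have hmain := lemma7_bond (slabGraph 3 k) p hp0 hp1 K' Kfin hK hA hB ((5 * k + 4) * t) one_pos Φ ?_ ?_ ?_
  · simpa using hmain
  · intro S hS _ S' hS'
    have hS'eq : S' = S.filter (· ∉ Q.closeSet k ρ ↑S) := Finset.mem_singleton.1 hS'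
    subst hS'eq
    refine ⟨(Finset.filter_subset _ S).trans hS, ?_⟩
    rw [hΦcoe]
    exact phi1_not_mem_evNear hfar
  · intro S _ _
    simp [Φ]
  · intro S' _ _
    by_cases hsmall : (Q.Uent k ρ (↑S' : BondConfig (slab 3 k))).ncard ≤ t
    · refine ⟨Kfin.filter fun e => ∃ u ∈ e, planar k u ∈
          (Uent_finite (Q := Q) (k := k) (ρ := ρ) (↑S' : BondConfig (slab 3 k))).toFinset, ?_, ?_⟩
      · refine (card_filter_colEdges_le k Kfin hKE _).trans ?_
        rw [← Set.ncard_eq_toFinset_card _ (Uent_finite (↑S' : BondConfig (slab 3 k)))]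
        exact Nat.mul_le_mul_left _ hsmall
      · intro S hS _ hmem e heT
        have hS'eq : S' = S.filter (· ∉ Q.closeSet k ρ ↑S) := Finset.mem_singleton.1 hmem
        constructor
        · intro heS
          by_contra heS'
          apply heT
          have hdiff : e ∈ (↑S : Set (Sym2 (slab 3 k))) \ Q.phi1 k ρ ↑S := by
            refine ⟨heS, ?_⟩
            rw [← hΦcoe, ← hS'eq]
            exact heS'
          obtain ⟨v, hve, hv⟩ := diff_phi1_subset_Uent (fun e he => hKE e (hS he)) hdiff
          rw [← hΦcoe, ← hS'eq] at hv
          exact Finset.mem_filter.2 ⟨hS heS, v, hve, (Set.Finite.mem_toFinset _).2 hv⟩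
        · intro heS'
          rw [hS'eq] at heS'
          exact (Finset.mem_filter.1 heS').1
    · refine ⟨∅, by simp, ?_⟩
      intro S _ hSA hmem
      exfalso
      apply hsmall
      have hS'eq : S' = S.filter (· ∉ Q.closeSet k ρ ↑S) := Finset.mem_singleton.1 hmem
      rw [hS'eq, hΦcoe, Uent_phi1]
      exact hSA.2

end Fact1Ent

end NTW17

end Literature.Probability.Percolation

end
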